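import Literature.NumberTheory.GaloisRepresentations.DeformationProfiniteLevel
import Literature.NumberTheory.GaloisRepresentations.DeformationCofinalSubgroups
import HarnessLib

/-!
# STUB-IDEAS companion — `stub_liftThree` — ideator k1 — GEN 8 (Plan 4: the R-side TREE MATCH)

Helper signatures for Plan 4 of `Cruxes/FreyModularity/STUB-IDEAS-stub_liftThree-1.md` (gen 8):
Wiles's deformation ring `R_Σ` and the map `φ_Σ : R_Σ ↠ T_Σ` are TYPABLE AND LARGELY CONSTRUCTIBLE
over modules the tree already PROVES:

* H0 (`unrDatum`, `unrDeformationRing_nonempty`, PROVED in the sibling file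
  `STUB_IDEAS_stub_liftThree_1g8_Ambient.lean`, split off only because it imports
  `PolarizedDeformationRingProofs`): a `PolarizedDatum F F p n 𝒪 k`
  with `Θ := ∅` has a VACUOUS polarization clause, so the tree's PROVED
  `polarizedDeformationRing_nonempty_holds` already yields the universal deformation ring of the
  lifts of `r̄ : Γ_F → GL_n(k)` unramified outside `S` (no condition above `p`, scalar centralizer)
  — the AMBIENT ring of which Wiles's `R_Σ` is a closed sub-problem;
* H1–H3 (sorried, S-sized bookkeeping): sub-conditions of a `Deformation.LiftingCondition` —
  intersection, a local condition pulled back along a continuous `ι : Δ →* Γ` (decomposition group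
  at `3`; the flat / ordinary condition enters ONLY as an abstract `LiftingCondition` on `Δ`), and a
  fixed-determinant clause — are again `LiftingCondition`s (Mazur §23, §26 Prop. 1);
* H4 (PROVED): Mazur's `Φ_p` input (finiteness of the `k[ε]`-points) is inherited by sub-conditions,
  so it comes for free from the tree's `PolarizedDatum.RigidData.finite_carrier_dualCNL`;
* H5 (PROVED): Mazur representability for ANY lifting condition on `Γ_F` with finitely many
  `k[ε]`-points — `LiftingCondition.exists_universal_of_finite` fed with the tree's cofinal tower
  `absoluteGaloisGroup_exists_antitone_openNormal_seq`.

Nothing here restates the stub, the crux or the summit; no new axioms.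
-/

noncomputable section

open IsLocalRing Field
open Literature.NumberTheory.GaloisRepresentations
open Literature.NumberTheory.GaloisRepresentations.Deformation

namespace Summit.ABC.ABC.Cruxes.FreyModularity.Sketch.StubIdeas1g8

universe u

/-! ## H1–H4: sub-conditions of a lifting condition -/

section SubConditions

variable {𝒪 : Type u} [CommRing 𝒪] {k : Type u} [Field k] [Algebra 𝒪 k]
variable {Γ : Type u} [Group Γ] [TopologicalSpace Γ] {n : ℕ} {rbar : Γ →* GL (Fin n) k}

/-- **H1** (S): the intersection of two lifting conditions for `r̄` is a lifting condition
(every axiom of `LiftingCondition` is closed under intersection; detection by jointly injective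
families is checked componentwise). [cite: Mazur1997Deformation, §23] -/
theorem exists_liftingCondition_inf (𝒞₁ 𝒞₂ : LiftingCondition 𝒪 k Γ n rbar) :
    ∃ 𝒞 : LiftingCondition 𝒪 k Γ n rbar, ∀ A, 𝒞.carrier A = 𝒞₁.carrier A ∩ 𝒞₂.carrier A := by
  sorry

/-- **H2** (S): a LOCAL condition pulled back along a continuous homomorphism `ι : Δ →* Γ`
(decomposition group `Γ_{ℚ_3} → Γ_ℚ`): if `𝒟` is a lifting condition for `r̄ ∘ ι` on `Δ`, the lifts
in an ambient condition `𝒞` whose restriction along `ι` lies in `𝒟` form a lifting condition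
(`IsAdicContinuous` is stable under composition with a continuous `ι`, which is what the
jointly-injective detection axiom of `𝒟` needs).  The flat-at-`3` (Ramakrishna) or ordinary-at-`3`
condition enters Plan 4 ONLY as such a `𝒟`. [cite: Mazur1997Deformation, §26 Prop. 1] -/
theorem exists_liftingCondition_local (𝒞 : LiftingCondition 𝒪 k Γ n rbar)
    {Δ : Type u} [Group Δ] [TopologicalSpace Δ] (ι : Δ →* Γ) (hι : Continuous ι)
    (𝒟 : LiftingCondition 𝒪 k Δ n (rbar.comp ι)) :
    ∃ 𝒞' : LiftingCondition 𝒪 k Γ n rbar,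
      ∀ A, 𝒞'.carrier A = {ρ ∈ 𝒞.carrier A | ρ.comp ι ∈ 𝒟.carrier A} := by
  sorry

/-- **H3** (S): the fixed-determinant clause `det ρ = ε` (for a character `ε : Γ → 𝒪ˣ` lifting
`det r̄`, e.g. the `3`-adic cyclotomic character) cuts a lifting condition out of a lifting
condition (a closed polynomial condition, detected by jointly injective families since
`φ_i (det ρ(γ) - ε(γ)) = 0` for all `i`). [cite: Mazur1997Deformation, §24] -/
theorem exists_liftingCondition_det (𝒞 : LiftingCondition 𝒪 k Γ n rbar) (ε : Γ →* 𝒪ˣ)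
    (hε : ∀ γ, (rbar γ).val.det = algebraMap 𝒪 k (ε γ : 𝒪)) :
    ∃ 𝒞' : LiftingCondition 𝒪 k Γ n rbar,
      ∀ A, 𝒞'.carrier A = {ρ ∈ 𝒞.carrier A | ∀ γ, (ρ γ).val.det = algebraMap 𝒪 A (ε γ : 𝒪)} := by
  sorry

/-- **H4** (XS, proved): Mazur's `Φ_p`-type input — finiteness of the `k[ε]`-points — is inherited
by sub-conditions. [folklore] -/
theorem finite_carrier_dualCNL_of_subset [Finite k] {𝒞 𝒞' : LiftingCondition 𝒪 k Γ n rbar}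
    (h : 𝒞.carrier (dualCNL 𝒪 k) ⊆ 𝒞'.carrier (dualCNL 𝒪 k))
    (hfin : (𝒞'.carrier (dualCNL 𝒪 k)).Finite) : (𝒞.carrier (dualCNL 𝒪 k)).Finite :=
  hfin.subset h

end SubConditions

/-! ## H5: Mazur representability on `Γ_F`, packaged with the tree's cofinal tower -/

section Universal

variable {F : Type} [Field F] [NumberField F]
variable {𝒪 : Type} [CommRing 𝒪] [IsNoetherianRing 𝒪] {k : Type} [Field k] [Finite k] [Algebra 𝒪 k]
variable {n : ℕ} {rbar : absoluteGaloisGroup F →* GL (Fin n) k}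

/-- **H5** (S, proved): every lifting condition for a continuous `r̄ : Γ_F → GL_n(k)` with finitely
many `k[ε]`-points is represented by an object `(R, ρ_R)` of `Ĉ_𝒪(k)` (rigid universal property:
unique classifying morphism, no strict-equivalence quotient).  `R_Σ` of Plan 4 := this `R` for the
type-`Σ` condition `𝒞_Σ` assembled by H1–H3 inside the rigid `S`-unramified condition.
[cite: Mazur1997Deformation, §20 Prop. 2] -/
theorem exists_universal_absoluteGaloisGroup
    (𝒞 : LiftingCondition 𝒪 k (absoluteGaloisGroup F) n rbar)
    (hk : Function.Surjective (algebraMap 𝒪 k))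
    (hker : IsOpen (rbar.ker : Set (absoluteGaloisGroup F)))
    (hfin : (𝒞.carrier (dualCNL 𝒪 k)).Finite) :
    ∃ (R : CNLAlgebra 𝒪 k) (ρR : absoluteGaloisGroup F →* GL (Fin n) R), ρR ∈ 𝒞.carrier R ∧
      ∀ (A : CNLAlgebra 𝒪 k) (ρ : absoluteGaloisGroup F →* GL (Fin n) A), ρ ∈ 𝒞.carrier A →
        ∃! φ : R →ₐ[𝒪] A, (Matrix.GeneralLinearGroup.map (φ : R →+* A)).comp ρR = ρ := by
  classical
  obtain ⟨U, hUn, hUo, hUanti, hUle, hUcof⟩ :=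
    absoluteGaloisGroup_exists_antitone_openNormal_seq F rbar.ker hker
  haveI : ∀ N, (U N).Normal := hUn
  haveI : ∀ N, Finite (absoluteGaloisGroup F ⧸ U N) :=
    fun N => Subgroup.quotient_finite_of_isOpen _ (hUo N)
  have hUo' : ∀ N ⦃H : Subgroup (absoluteGaloisGroup F)⦄, U N ≤ H →
      IsOpen (H : Set (absoluteGaloisGroup F)) :=
    fun N H hH => Subgroup.isOpen_mono hH (hUo N)
  exact 𝒞.exists_universal_of_finite hk U hUle hUo' hUanti (fun V _ hV => hUcof V hV) hfin

end Universal

end Summit.ABC.ABC.Cruxes.FreyModularity.Sketch.StubIdeas1g8
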